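import Summits.Ventures.QEC.Census.BB.Claims
import Literature.InformationTheory.QuantumCodes.SyndromeDecodingCSSPauli
import HarnessLib

/-!
# Ventures/QEC — Decoders/BBOptimalRadius: a certified bivariate-bicycle row `[[n, k, d]]` fixes the optimal correction
# radius `⌊(d−1)/2⌋` of the code — the Q4 «theorem column» for family BB, once and for all (qec PARTITION row 08)

HONEST FRAMING: CERTIFIED column; pure theorems (no `decide`, no data), axioms ⊆ {propext, Classical.choice, Quot.sound}.
Input: a PROVED census row predicate `Summit.Ventures.QEC.BB.HasParams C n k d` (`Census/BB/Claims.lean`; e.g.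
`BB72_12_6_claim_holds`, and the `[[144,12,12]]` / `[[90,8,10]]` claims when their routes close) with `0 < d`.
Output, for the typed code `C.css` (qubits `Mono ℓ m ⊕ Mono ℓ m`) and for its flat form `C.cssFlat` (qubits
`Fin (ℓm + ℓm)`, the certificate checker's shape):
* `optimalRadiusX_of_hasParams` / `optimalRadiusZ_of_hasParams` — some `X`-decoder (resp. `Z`-decoder), namely
  minimum-weight decoding, has correction radius EXACTLY `⌊(d−1)/2⌋`, and NO decoder of that sector — no function of the
  syndrome whatsoever — corrects every error of a larger weight (`CSSCode.optimalRadiusX/Z`: Gottesman 1997 §2.3 «distance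
  at least 2t+1»; Delfosse–Nickerson §3 «tight»; `d^X = d^Z = d` by Lemma 1 of Bravyi et al. 2024, `dX_eq_of_hasParams`);
* `optimalRadius_cssFlat_of_hasParams` — at the Pauli level on the flat code: some Pauli decoder has correction radius
  exactly `⌊(d−1)/2⌋` in symplectic weight and NO Pauli decoder (sector-wise or not) corrects more (`CSSCode.optimalRadius`,
  via `cssFlat_dX` / `cssFlat_dZ`).
So every KERNEL-certified BB row carries its Q4 theorem-column entry «radius ⌊(d−1)/2⌋, optimal, attained» with no further
computation; explicit decoder TABLES (BP+OSD, syndrome tables) are the separate kernel-table lane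
(`Decoders/RadiusCheckTree.lean`, `Decoders/BB72SyndromeTable.lean`). Nothing probabilistic (thresholds: VALIDATED column).
-/

namespace Summit.Ventures.QEC.BB

open Literature.InformationTheory.QuantumCodes Literature.InformationTheory.QuantumCodes.BB

variable {ℓ m : ℕ} [NeZero ℓ] [NeZero m] {C : BB.Code ℓ m} {n k d : ℕ}

/-- A certified row `[[n,k,d]]` with `0 < d` gives an `X`-logical of the typed code (`d^X = d > 0`, `CSSCode.dX_pos_iff`). -/
theorem exists_xLogical_of_hasParams (h : HasParams C n k d) (hd : 0 < d) :
    ∃ v : Mono ℓ m ⊕ Mono ℓ m → ZMod 2, C.css.HZ.mulVec v = 0 ∧ v ∉ C.css.rowSpX :=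
  C.css.dX_pos_iff.1 (by rw [(dX_eq_of_hasParams h).1]; exact hd)

/-- A certified row `[[n,k,d]]` with `0 < d` gives a `Z`-logical of the typed code. -/
theorem exists_zLogical_of_hasParams (h : HasParams C n k d) (hd : 0 < d) :
    ∃ v : Mono ℓ m ⊕ Mono ℓ m → ZMod 2, C.css.HX.mulVec v = 0 ∧ v ∉ C.css.rowSpZ :=
  C.css.dZ_pos_iff.1 (by rw [(dX_eq_of_hasParams h).2]; exact hd)

/-- **Q4 theorem column, `X`-sector**: if `QC(A,B)` has certified parameters `[[n,k,d]]`, `0 < d`, then some `X`-decoder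
(minimum-weight decoding) has correction radius EXACTLY `⌊(d−1)/2⌋` on `C.css`, and NO `X`-decoder corrects every
`X`-error of a larger weight. [cite: Gottesman1997, §2.3 (chunk p0014 L3)] -/
theorem optimalRadiusX_of_hasParams (h : HasParams C n k d) (hd : 0 < d) :
    (∃ D : Decoder (Mono ℓ m → ZMod 2) (Mono ℓ m ⊕ Mono ℓ m → ZMod 2),
        D.IsCorrectionRadius C.css.xSyndrome (C.css.rowSpX : Set (Mono ℓ m ⊕ Mono ℓ m → ZMod 2)) hammingNorm
          ((d - 1) / 2)) ∧
      ∀ (D : Decoder (Mono ℓ m → ZMod 2) (Mono ℓ m ⊕ Mono ℓ m → ZMod 2)) (t : ℕ),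
        D.CorrectsUpTo C.css.xSyndrome (C.css.rowSpX : Set (Mono ℓ m ⊕ Mono ℓ m → ZMod 2)) hammingNorm t →
          t ≤ (d - 1) / 2 := by
  have hopt := C.css.optimalRadiusX (exists_xLogical_of_hasParams h hd)
  rwa [(dX_eq_of_hasParams h).1] at hopt

/-- **Q4 theorem column, `Z`-sector**: radius EXACTLY `⌊(d−1)/2⌋` attained by minimum-weight `Z`-decoding and
unbeatable by any `Z`-decoder. [cite: Gottesman1997, §2.3 (chunk p0014 L3)] -/
theorem optimalRadiusZ_of_hasParams (h : HasParams C n k d) (hd : 0 < d) :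
    (∃ D : Decoder (Mono ℓ m → ZMod 2) (Mono ℓ m ⊕ Mono ℓ m → ZMod 2),
        D.IsCorrectionRadius C.css.zSyndrome (C.css.rowSpZ : Set (Mono ℓ m ⊕ Mono ℓ m → ZMod 2)) hammingNorm
          ((d - 1) / 2)) ∧
      ∀ (D : Decoder (Mono ℓ m → ZMod 2) (Mono ℓ m ⊕ Mono ℓ m → ZMod 2)) (t : ℕ),
        D.CorrectsUpTo C.css.zSyndrome (C.css.rowSpZ : Set (Mono ℓ m ⊕ Mono ℓ m → ZMod 2)) hammingNorm t →
          t ≤ (d - 1) / 2 := by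
  have hopt := C.css.optimalRadiusZ (exists_zLogical_of_hasParams h hd)
  rwa [(dX_eq_of_hasParams h).2] at hopt

/-- **Q4 theorem column, Pauli level (flat code)**: if `QC(A,B)` has certified parameters `[[n,k,d]]`, `0 < d`, then on
the flat CSS code `C.cssFlat` (qubits `Fin (ℓm + ℓm)`) some Pauli decoder has correction radius EXACTLY `⌊(d−1)/2⌋` in
symplectic weight (sector-wise minimum-weight decoding) and NO Pauli decoder — sector-wise or not — corrects more.
[cite: Gottesman1997, §2.3 (chunk p0014 L3)] [cite: DelfosseNickerson2021, §3 ¶2 (chunk p0006 L8–13)] -/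
theorem optimalRadius_cssFlat_of_hasParams (h : HasParams C n k d) (hd : 0 < d) :
    (∃ D : Decoder ((Fin (ℓ * m) → ZMod 2) × (Fin (ℓ * m) → ZMod 2)) (SympVec (ℓ * m + ℓ * m)),
        D.IsCorrectionRadius (cssSyndrome C.cssFlat.xSyndrome C.cssFlat.zSyndrome)
          (C.cssFlat.toSympCode : Set (SympVec (ℓ * m + ℓ * m))) sympWeight ((d - 1) / 2)) ∧
      ∀ (D : Decoder ((Fin (ℓ * m) → ZMod 2) × (Fin (ℓ * m) → ZMod 2)) (SympVec (ℓ * m + ℓ * m))) (t : ℕ),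
        D.CorrectsUpTo (cssSyndrome C.cssFlat.xSyndrome C.cssFlat.zSyndrome)
          (C.cssFlat.toSympCode : Set (SympVec (ℓ * m + ℓ * m))) sympWeight t → t ≤ (d - 1) / 2 := by
  have hX : C.cssFlat.dX = d := C.cssFlat_dX.trans (dX_eq_of_hasParams h).1
  have hZ : C.cssFlat.dZ = d := C.cssFlat_dZ.trans (dX_eq_of_hasParams h).2
  have hopt := C.cssFlat.optimalRadius (C.cssFlat.dX_pos_iff.1 (by rw [hX]; exact hd))
    (C.cssFlat.dZ_pos_iff.1 (by rw [hZ]; exact hd))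
  rwa [hX, hZ, min_self] at hopt

end Summit.Ventures.QEC.BB
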